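import Summits.AtomisticToContinuum.Crystallization.Theorems.FrustratedLawDichotomyCellTails

/-!
# FrustratedLawDichotomy · crux `AperiodicFrustratedLawGap` (stmt-AtomisticToContinuum-27623) — CELL-SOUND III: DEBITS, REMAINDER, THE TRUNCATED MASTER
(cell decomp-a2c, lens-5 g113; continues `…CellTails`)

1. ★ (b) `debitL_le_near_add_tail` — root-bond debits `τ²·secondNeg + energyRem`: near-root list `ML ⊇ {‖pos m‖ < L_D}` + `debTail δ L_D τ`
   ((hand-1) `secondNeg_le_inv_pow`, `energyRem_le_far`).
2. ★ (f) `remL_le_near_add_tail` — force-remainder column: near-pair lists `nbr m ⊇ {dist < L_R}` + `(Σ‖Y‖)·remTail δ L_R τ`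
   ((hand-1) `forceRem_mono_right`, `forceRem_le_far`; no symmetry of the lists is needed — the exchanged half is summed by `Finset.sum_comm'`).
3. ★★ `lb_le_certFloorL_trunc` — THE TRUNCATED MASTER = the exact hypothesis list a cell K-file's soundness lemma discharges: label side
   conditions of the lists `MN nb ML nbr nbh`, radii `L_N R_N L_D L_R Lh`, and certified numbers `host deb nn hf fc RM SY tc`; conclusion
   `Σhost − (Σ_{ML}deb + debTail) − τ(Σ_{MN}nn + T0_δ(R_N) + 2·SY·TL_δ(L_N)) − Σhf − Σfc − (RM + SY·remTail) − tc ≤ certFloorL`.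
   With `…CellFrame.rowFloor_of_cells` this is the whole class-A row pipeline: K-number `≥ 2(cUp + mc)` uniformly over the box ⇒ `hfloor`.
Dials of record (crit r1764 R1, (hand-1) TAILS memo): `τ_A = 1/1024`, `L_N = 5` (`TL_δ(5) ≈ 1.5e-3`), `R_N = 8`, `L_D = L_R = 3`, `δ = 7/10`.

House conventions: SI units · italic scalars, bold vectors, sans-serif tensors · numbered formulae only when referenced · en-dash for
ranges · References = cited works, numbered, alphabetical · no footnotes; Remarks at section ends · British spelling, -ise · Lennard-Jones
hyphenated; NASH capitalised as the Statement's notion · "folklore" tags standard bookkeeping; no new references are cited in this file.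
-/

noncomputable section

namespace Summit.AtomisticToContinuum.Crystallization.Theorems.FrustratedLawDichotomyCellTailsRem

open MeasureTheory Metric Set RealInnerProductSpace
open scoped BigOperators
open Literature.MathematicalPhysics.StatisticalMechanics (lennardJones rootEnergy)
open Literature.Probability.Process (IsRootedHardCore)
open Summit.AtomisticToContinuum.Crystallization.Theorems.ChargedEnergyGapNegative (E3)
open Summit.AtomisticToContinuum.Crystallization.Theorems.FrustratedLawDichotomyCoherentSets (coherentAt)
open Summit.AtomisticToContinuum.Crystallization.Theorems.FrustratedLawDichotomyCoherentFloorAlgebra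
open Summit.AtomisticToContinuum.Crystallization.Theorems.FrustratedLawDichotomyCoherentFloor
open Summit.AtomisticToContinuum.Crystallization.Theorems.FrustratedLawDichotomyCertFloorTails
open Summit.AtomisticToContinuum.Crystallization.Theorems.FrustratedLawDichotomyCertFloorTailsRem
open Summit.AtomisticToContinuum.Crystallization.Theorems.FrustratedLawDichotomyCertFloorTailsEnergy
open Summit.AtomisticToContinuum.Crystallization.Theorems.FrustratedLawDichotomyWindowSymmetry (sum_ljForce_eq_zero_of_neg_mem)
open Summit.AtomisticToContinuum.Crystallization.Theorems.FrustratedLawDichotomyCellFrame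
open Summit.AtomisticToContinuum.Crystallization.Theorems.FrustratedLawDichotomyCellTails

variable {ι : Type*} [DecidableEq ι]

section Trunc

variable {M MI : Finset ι} {pos Y : ι → E3}

/-! ### (b) the root-bond debits: near-root list + `debTail` -/

/-- ★ ROOT-BOND DEBITS, truncated ((hand-1) `energyDebit_le_near_add_tail` in labels, near-root LIST `ML ⊇ {‖pos m‖ < L}`):
`Σ_{m∈M∖o}(τ²·secondNeg + energyRem) ≤ Σ_{m∈ML}(same) + debTail δ L τ` (`0 ≤ τ < L`, `δ/2 ≤ L`). [folklore] -/
theorem debitL_le_near_add_tail (o : ι) (ML : Finset ι) {δ L τ : ℝ} (hδ : 0 < δ) (hL : δ / 2 ≤ L) (hτ0 : 0 ≤ τ) (hτL : τ < L)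
    (hsep : ∀ z ∈ M, ∀ z' ∈ M, z ≠ z' → δ ≤ dist (pos z) (pos z')) (hML : ML ⊆ M.erase o)
    (hMLc : ∀ m ∈ M.erase o, m ∉ ML → L ≤ ‖pos m‖) :
    ∑ m ∈ M.erase o, (τ ^ 2 * secondNeg ‖pos m‖ + energyRem ‖pos m‖ τ)
      ≤ ∑ m ∈ ML, (τ ^ 2 * secondNeg ‖pos m‖ + energyRem ‖pos m‖ τ) + debTail δ L τ := by
  classical
  have hinj : Set.InjOn pos ↑M := injOn_of_sep hδ hsep
  have hL0 : 0 < L := lt_of_lt_of_le (by positivity) hL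
  rw [← Finset.sum_filter_add_sum_filter_not (M.erase o) (fun m => m ∈ ML), Finset.filter_mem_eq_inter,
    Finset.inter_eq_right.mpr hML]
  refine add_le_add le_rfl ?_
  set Sf := (M.erase o).filter (fun m => ¬ m ∈ ML) with hSf
  have hfar : ∀ a ∈ Sf, L ≤ dist (pos a) 0 := by
    intro a ha
    obtain ⟨ha1, ha2⟩ := Finset.mem_filter.mp ha
    rw [dist_zero_right]
    exact hMLc a ha1 ha2
  have hsepS : ∀ a ∈ Sf, ∀ b ∈ Sf, a ≠ b → δ ≤ dist (pos a) (pos b) := fun a ha b hb hab =>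
    hsep a (Finset.mem_of_mem_erase (Finset.mem_filter.mp ha).1) b (Finset.mem_of_mem_erase (Finset.mem_filter.mp hb).1) hab
  have hSM : Sf ⊆ M := (Finset.filter_subset _ _).trans (Finset.erase_subset o M)
  -- termwise: `τ²·secondNeg r ≤ τ²(7/2 r⁻⁸ + 1/2 r⁻¹⁴)`, `energyRem r τ ≤ τ³(B₉ r⁻⁹ + B₁₅ r⁻¹⁵)` with `r = dist (pos m) 0 ≥ L`
  have hterm : ∀ a ∈ Sf, τ ^ 2 * secondNeg ‖pos a‖ + energyRem ‖pos a‖ τ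
      ≤ τ ^ 2 * (7 / 2 * (dist (pos a) 0)⁻¹ ^ 8 + 1 / 2 * (dist (pos a) 0)⁻¹ ^ 14)
        + τ ^ 3 * (B9 (τ / L) * (dist (pos a) 0)⁻¹ ^ 9 + B15 (τ / L) * (dist (pos a) 0)⁻¹ ^ 15) := by
    intro a ha
    have hr : L ≤ ‖pos a‖ := by have h := hfar a ha; rwa [dist_zero_right] at h
    rw [dist_zero_right]
    have h1 := secondNeg_le_inv_pow (norm_nonneg (pos a))
    have h2 := energyRem_le_far hτ0 hτL hr
    unfold B9 B15
    nlinarith [sq_nonneg τ]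
  refine (Finset.sum_le_sum hterm).trans ?_
  rw [Finset.sum_add_distrib, ← Finset.mul_sum, ← Finset.mul_sum]
  have hB9 : 0 ≤ B9 (τ / L) := by
    unfold B9
    have hq : 0 < 1 - τ / L := by rw [sub_pos, div_lt_one hL0]; exact hτL
    have : 0 ≤ τ / L := div_nonneg hτ0 hL0.le
    positivity
  have hB15 : 0 ≤ B15 (τ / L) := by
    unfold B15
    have hq : 0 < 1 - τ / L := by rw [sub_pos, div_lt_one hL0]; exact hτL
    have : 0 ≤ τ / L := div_nonneg hτ0 hL0.le
    positivity
  have h8 := sum_shellTail_le_L hinj hSM 0 hδ hL (by norm_num : (0:ℝ) ≤ 7 / 2) (by norm_num : (0:ℝ) ≤ 1 / 2) hsepS hfar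
  have h9 := sum_remTail_le_L hinj hSM 0 hδ hL hB9 hB15 hsepS hfar
  unfold debTail
  have hτ2 : 0 ≤ τ ^ 2 := sq_nonneg τ
  have hτ3 : 0 ≤ τ ^ 3 := pow_nonneg hτ0 3
  nlinarith [mul_le_mul_of_nonneg_left h8 hτ2, mul_le_mul_of_nonneg_left h9 hτ3]

/-! ### (f) the force-remainder column: symmetric near-pair lists + `remTail` -/

/-- `dispL` sums are in `[0, 2τ]` and strictly below any `L > 2τ`. [folklore] -/
theorem dispL_add_mem (o : ι) {τ : ℝ} (hτ0 : 0 ≤ τ) (m m' : ι) :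
    0 ≤ dispL o τ m + dispL o τ m' ∧ dispL o τ m + dispL o τ m' ≤ 2 * τ := by
  unfold dispL
  constructor <;> split_ifs <;> linarith

/-- ★ FORCE-REMAINDER COLUMN, truncated ((hand-1) `remColumn_le_near_add_tail` in labels, with near-pair LISTS `nbr m ⊇ {dist < L}`):
`½ΣΣ_{all pairs} ‖YE_m − YE_m'‖·forceRem ≤ ½ΣΣ_{m' ∈ nbr m}(same) + (Σ_{x∈MI}‖Y_x‖)·remTail δ L τ` (`0 ≤ τ`, `2τ < L`, `δ/2 ≤ L`). [folklore] -/
theorem remL_le_near_add_tail (o : ι) (nbr : ι → Finset ι) {δ L τ : ℝ} (hδ : 0 < δ) (hL : δ / 2 ≤ L) (hτ0 : 0 ≤ τ) (hτL : 2 * τ < L)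
    (hsep : ∀ z ∈ M, ∀ z' ∈ M, z ≠ z' → δ ≤ dist (pos z) (pos z')) (hMI : MI ⊆ M)
    (hnbr : ∀ m ∈ M, ∀ m' ∈ M, m' ≠ m → m' ∉ nbr m → L ≤ dist (pos m') (pos m)) :
    1 / 2 * ∑ m ∈ M, ∑ m' ∈ M.erase m, ‖YE MI Y m - YE MI Y m'‖ * forceRem ‖pos m - pos m'‖ (dispL o τ m + dispL o τ m')
      ≤ 1 / 2 * ∑ m ∈ M, ∑ m' ∈ (M.erase m).filter (fun m' => m' ∈ nbr m),
            ‖YE MI Y m - YE MI Y m'‖ * forceRem ‖pos m - pos m'‖ (dispL o τ m + dispL o τ m')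
        + (∑ x ∈ MI, ‖Y x‖) * remTail δ L τ := by
  classical
  have hinj : Set.InjOn pos ↑M := injOn_of_sep hδ hsep
  have hL0 : 0 < L := lt_of_lt_of_le (by positivity) hL
  have hq : 0 < 1 - 2 * τ / L := by rw [sub_pos, div_lt_one hL0]; exact hτL
  have hqq : 0 ≤ 2 * τ / L := div_nonneg (by linarith) hL0.le
  have hA9 : 0 ≤ A9 (2 * τ / L) := by unfold A9; positivity
  have hA15 : 0 ≤ A15 (2 * τ / L) := by unfold A15; positivity
  -- opaque bond weight
  set w : ι → ι → ℝ := fun m m' => (2 * τ) ^ 2 * (A9 (2 * τ / L) * (dist (pos m') (pos m))⁻¹ ^ 9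
    + A15 (2 * τ / L) * (dist (pos m') (pos m))⁻¹ ^ 15) with hw
  -- (1) split every inner sum into near + far
  have hsplit : ∀ m ∈ M, ∑ m' ∈ M.erase m, ‖YE MI Y m - YE MI Y m'‖ * forceRem ‖pos m - pos m'‖ (dispL o τ m + dispL o τ m')
      = ∑ m' ∈ (M.erase m).filter (fun m' => m' ∈ nbr m),
            ‖YE MI Y m - YE MI Y m'‖ * forceRem ‖pos m - pos m'‖ (dispL o τ m + dispL o τ m')
        + ∑ m' ∈ (M.erase m).filter (fun m' => ¬ m' ∈ nbr m),
            ‖YE MI Y m - YE MI Y m'‖ * forceRem ‖pos m - pos m'‖ (dispL o τ m + dispL o τ m') :=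
    fun m _ => (Finset.sum_filter_add_sum_filter_not _ _ _).symm
  rw [Finset.sum_congr rfl hsplit, Finset.sum_add_distrib, mul_add]
  refine add_le_add le_rfl ?_
  -- (2) far terms: `‖YE m − YE m'‖ ≤ ‖YE m‖ + ‖YE m'‖`, `forceRem ≤ w`
  have hfar_term : ∀ m ∈ M, ∀ m' ∈ (M.erase m).filter (fun m' => ¬ m' ∈ nbr m),
      ‖YE MI Y m - YE MI Y m'‖ * forceRem ‖pos m - pos m'‖ (dispL o τ m + dispL o τ m') ≤ (‖YE MI Y m‖ + ‖YE MI Y m'‖) * w m m' := by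
    intro m hm m' hm'
    obtain ⟨hm'1, hm'2⟩ := Finset.mem_filter.mp hm'
    have hd : L ≤ dist (pos m') (pos m) := hnbr m hm m' (Finset.mem_of_mem_erase hm'1) (Finset.ne_of_mem_erase hm'1) hm'2
    have hr : L ≤ ‖pos m - pos m'‖ := by rwa [← dist_eq_norm, dist_comm]
    obtain ⟨hη0, hη2⟩ := dispL_add_mem o hτ0 m m'
    have hmono := forceRem_mono_right hη0 hη2 (by linarith : 2 * τ < ‖pos m - pos m'‖)
    have hfarb := forceRem_le_far (L := L) (r := ‖pos m - pos m'‖) (by linarith : (0:ℝ) ≤ 2 * τ) hτL hr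
    have hwe : w m m' = (2 * τ) ^ 2 * (A9 (2 * τ / L) * (‖pos m - pos m'‖)⁻¹ ^ 9 + A15 (2 * τ / L) * (‖pos m - pos m'‖)⁻¹ ^ 15) := by
      simp only [hw]
      rw [dist_comm, dist_eq_norm]
    rw [hwe]
    unfold A9 A15
    exact mul_le_mul (norm_sub_le _ _) (hmono.trans hfarb) (forceRem_nonneg (norm_nonneg _) hη0) (by positivity)
  have h2 : ∑ m ∈ M, ∑ m' ∈ (M.erase m).filter (fun m' => ¬ m' ∈ nbr m),
        ‖YE MI Y m - YE MI Y m'‖ * forceRem ‖pos m - pos m'‖ (dispL o τ m + dispL o τ m')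
      ≤ ∑ m ∈ M, ∑ m' ∈ (M.erase m).filter (fun m' => ¬ m' ∈ nbr m), (‖YE MI Y m‖ * w m m' + ‖YE MI Y m'‖ * w m m') := by
    refine Finset.sum_le_sum fun m hm => Finset.sum_le_sum fun m' hm' => ?_
    rw [← add_mul]
    exact hfar_term m hm m' hm'
  -- (3) the shell sum around any `m ∈ M` over its far set
  have hshell : ∀ m ∈ M, ∑ m' ∈ (M.erase m).filter (fun m' => ¬ m' ∈ nbr m), w m m' ≤ remTail δ L τ := by
    intro m hm
    simp only [hw]
    rw [← Finset.mul_sum]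
    unfold remTail
    refine mul_le_mul_of_nonneg_left ?_ (sq_nonneg _)
    refine sum_remTail_le_L hinj ((Finset.filter_subset _ _).trans (Finset.erase_subset m M)) (pos m) hδ hL hA9 hA15
      (fun u hu v hv huv => ?_) (fun u hu => ?_)
    · exact hsep u (Finset.mem_of_mem_erase (Finset.mem_filter.mp hu).1) v (Finset.mem_of_mem_erase (Finset.mem_filter.mp hv).1) huv
    · obtain ⟨hu1, hu2⟩ := Finset.mem_filter.mp hu
      exact hnbr m hm u (Finset.mem_of_mem_erase hu1) (Finset.ne_of_mem_erase hu1) hu2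
  -- (3') and around any `m' ∈ M` over the set of `m` it is far from (same hypothesis, exchanged roles)
  have hshell' : ∀ m' ∈ M, ∑ m ∈ (M.erase m').filter (fun m => ¬ m' ∈ nbr m), w m m' ≤ remTail δ L τ := by
    intro m' hm'
    have ew : ∀ m, w m m' = (2 * τ) ^ 2 * (A9 (2 * τ / L) * (dist (pos m) (pos m'))⁻¹ ^ 9
        + A15 (2 * τ / L) * (dist (pos m) (pos m'))⁻¹ ^ 15) := fun m => by simp only [hw, dist_comm (pos m') (pos m)]
    simp only [ew]
    rw [← Finset.mul_sum]
    unfold remTail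
    refine mul_le_mul_of_nonneg_left ?_ (sq_nonneg _)
    refine sum_remTail_le_L hinj ((Finset.filter_subset _ _).trans (Finset.erase_subset m' M)) (pos m') hδ hL hA9 hA15
      (fun u hu v hv huv => ?_) (fun u hu => ?_)
    · exact hsep u (Finset.mem_of_mem_erase (Finset.mem_filter.mp hu).1) v (Finset.mem_of_mem_erase (Finset.mem_filter.mp hv).1) huv
    · obtain ⟨hu1, hu2⟩ := Finset.mem_filter.mp hu
      have h := hnbr u (Finset.mem_of_mem_erase hu1) m' hm' (Finset.ne_of_mem_erase hu1).symm hu2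
      rwa [dist_comm] at h
  -- (4) the two halves
  rw [Finset.sum_congr rfl fun m _ => Finset.sum_add_distrib] at h2
  rw [Finset.sum_add_distrib] at h2
  have hYE : ∀ m, ‖YE MI Y m‖ = if m ∈ MI then ‖Y m‖ else 0 := by
    intro m; unfold YE; split_ifs <;> simp
  have h4a : ∑ m ∈ M, ∑ m' ∈ (M.erase m).filter (fun m' => ¬ m' ∈ nbr m), ‖YE MI Y m‖ * w m m'
      ≤ (∑ x ∈ MI, ‖Y x‖) * remTail δ L τ := by
    calc ∑ m ∈ M, ∑ m' ∈ (M.erase m).filter (fun m' => ¬ m' ∈ nbr m), ‖YE MI Y m‖ * w m m'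
        = ∑ m ∈ M, ‖YE MI Y m‖ * ∑ m' ∈ (M.erase m).filter (fun m' => ¬ m' ∈ nbr m), w m m' := by
          refine Finset.sum_congr rfl fun m _ => ?_; rw [Finset.mul_sum]
      _ ≤ ∑ m ∈ M, ‖YE MI Y m‖ * remTail δ L τ :=
          Finset.sum_le_sum fun m hm => mul_le_mul_of_nonneg_left (hshell m hm) (norm_nonneg _)
      _ = (∑ x ∈ MI, ‖Y x‖) * remTail δ L τ := by
          rw [← Finset.sum_mul]
          congr 1
          simp only [hYE]
          rw [Finset.sum_ite_mem, Finset.inter_eq_right.mpr hMI]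
  have h4b : ∑ m ∈ M, ∑ m' ∈ (M.erase m).filter (fun m' => ¬ m' ∈ nbr m), ‖YE MI Y m'‖ * w m m'
      ≤ (∑ x ∈ MI, ‖Y x‖) * remTail δ L τ := by
    rw [Finset.sum_comm' (t' := M) (s' := fun m' => (M.erase m').filter (fun m => ¬ m' ∈ nbr m)) (h := ?_)]
    · calc ∑ m' ∈ M, ∑ m ∈ (M.erase m').filter (fun m => ¬ m' ∈ nbr m), ‖YE MI Y m'‖ * w m m'
          = ∑ m' ∈ M, ‖YE MI Y m'‖ * ∑ m ∈ (M.erase m').filter (fun m => ¬ m' ∈ nbr m), w m m' := by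
            refine Finset.sum_congr rfl fun m' _ => ?_; rw [Finset.mul_sum]
        _ ≤ ∑ m' ∈ M, ‖YE MI Y m'‖ * remTail δ L τ :=
            Finset.sum_le_sum fun m' hm' => mul_le_mul_of_nonneg_left (hshell' m' hm') (norm_nonneg _)
        _ = (∑ x ∈ MI, ‖Y x‖) * remTail δ L τ := by
            rw [← Finset.sum_mul]
            congr 1
            simp only [hYE]
            rw [Finset.sum_ite_mem, Finset.inter_eq_right.mpr hMI]
    · intro m m'
      simp only [Finset.mem_filter, Finset.mem_erase]
      constructor
      · rintro ⟨hm, ⟨hne, hm'⟩, hn⟩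
        exact ⟨⟨⟨fun h => hne h.symm, hm⟩, hn⟩, hm'⟩
      · rintro ⟨⟨⟨hne, hm⟩, hn⟩, hm'⟩
        exact ⟨hm, ⟨fun h => hne h.symm, hm'⟩, hn⟩
  linarith

/-! ### ★★ The TRUNCATED MASTER: what a cell K-file's soundness lemma proves, hypothesis by hypothesis -/

/-- Tails are nonnegative (needed to trade `Σ‖Y‖` for its certified upper bound `SY`). [folklore] -/
theorem linTail_nonneg {δ L : ℝ} (hδ : 0 < δ) (hL : 0 < L) : 0 ≤ linTail δ L := by
  unfold linTail S5 S11; positivity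

/-- [folklore] -/
theorem remTail_nonneg {δ L τ : ℝ} (hδ : 0 < δ) (hL : 0 < L) (hτ0 : 0 ≤ τ) (hτL : 2 * τ < L) : 0 ≤ remTail δ L τ := by
  have hq : 0 < 1 - 2 * τ / L := by rw [sub_pos, div_lt_one hL]; exact hτL
  have hqq : 0 ≤ 2 * τ / L := div_nonneg (by linarith) hL.le
  unfold remTail A9 A15 S6 S12; positivity

/-- ★★ **CELL-SOUND, THE TRUNCATED MASTER (label frame).**  For a cell placement `pos` with multipliers `Y` on `MI`, `δ`-separated labels,
truncation dials `(L_N, R_N, L_D, L_R)` and per-site radii `Lh`, near LISTS chosen by the K-file (`MN, nb` NASH; `ML` debits; `nbr` remainder;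
`nbh` host force) with their LABEL side conditions, and CERTIFIED NUMBERS — per-label host lower bounds `host`, near debits `deb`, near NASH
terms `nn`, truncated host-force pairings `hf` (near part + `‖Y_m‖·T0_δ(Lh m)`), far-force terms `fc`, the near remainder double sum `RM`,
`Σ‖Y‖ ≤ SY`, `tailCol Rc ≤ tc` — the certificate floor is at least the K-file's number:
`Σ host − (Σ_{ML} deb + debTail) − τ(Σ_{MN} nn + T0_δ(R_N) + 2·SY·TL_δ(L_N)) − Σ hf − Σ fc − (RM + SY·remTail) − tc ≤ certFloorL`. [folklore] -/
theorem lb_le_certFloorL_trunc (o : ι) {τ Rc δ L_N R_N L_D L_R : ℝ} (hτ0 : 0 ≤ τ) (hδ : 0 < δ)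
    (hsep : ∀ z ∈ M, ∀ z' ∈ M, z ≠ z' → δ ≤ dist (pos z) (pos z')) (hMI : MI ⊆ M)
    -- NASH column: near sites `MN`, near bonds `nb`
    (MN : Finset ι) (nb : ι → Finset ι) (hLN : δ / 2 ≤ L_N) (hRN : δ / 2 ≤ R_N)
    (hnb : ∀ z ∈ M, ∀ x ∈ M, x ≠ z → x ∉ nb z → L_N ≤ dist (pos x) (pos z)) (hMN : MN ⊆ M.erase o)
    (hMNc : ∀ m ∈ M.erase o, m ∉ MN → R_N ≤ ‖pos m‖ ∧ m ∉ MI ∧ ∀ x ∈ MI, x ∉ nb m)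
    -- root-bond debits: near-root list `ML`
    (ML : Finset ι) (hLD : δ / 2 ≤ L_D) (hτD : τ < L_D) (hML : ML ⊆ M.erase o) (hMLc : ∀ m ∈ M.erase o, m ∉ ML → L_D ≤ ‖pos m‖)
    -- force remainder: near-pair lists `nbr`
    (nbr : ι → Finset ι) (hLR : δ / 2 ≤ L_R) (hτR : 2 * τ < L_R)
    (hnbr : ∀ m ∈ M, ∀ m' ∈ M, m' ≠ m → m' ∉ nbr m → L_R ≤ dist (pos m') (pos m))
    -- host-force pairings: near lists `nbh`, radii `Lh`
    (nbh : ι → Finset ι) (Lh : ι → ℝ) (hLh : ∀ m ∈ MI, δ / 2 ≤ Lh m)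
    (hnbh : ∀ m ∈ MI, ∀ m' ∈ M, m' ≠ m → m' ∉ nbh m → Lh m ≤ dist (pos m') (pos m))
    -- the certified numbers
    (host : ι → ℝ) (hhost : ∀ m ∈ M.erase o, host m ≤ phiT (‖pos m‖ ^ 2))
    (deb : ι → ℝ) (hdeb : ∀ m ∈ ML, τ ^ 2 * secondNeg ‖pos m‖ + energyRem ‖pos m‖ τ ≤ deb m)
    (nn : ι → ℝ) (hnn : ∀ m ∈ MN, ‖psiT (‖pos m‖ ^ 2) • pos m - certCoeffNearL M MI pos Y nb m‖ ≤ nn m)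
    (hf : ι → ℝ) (hhf : ∀ m ∈ MI, ⟪Y m, ∑ m' ∈ (M.erase m).filter (fun m' => m' ∈ nbh m), ljBondForce (pos m - pos m')⟫
      + ‖Y m‖ * psiTail δ (Lh m) ≤ hf m)
    (fc : ι → ℝ) (hfc : ∀ m ∈ MI, ‖Y m‖ * farCol (Rc - (‖pos m‖ + τ)) ≤ fc m)
    (RM : ℝ) (hRM : 1 / 2 * ∑ m ∈ M, ∑ m' ∈ (M.erase m).filter (fun m' => m' ∈ nbr m),
      ‖YE MI Y m - YE MI Y m'‖ * forceRem ‖pos m - pos m'‖ (dispL o τ m + dispL o τ m') ≤ RM)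
    (SY : ℝ) (hSY : ∑ x ∈ MI, ‖Y x‖ ≤ SY) (tc : ℝ) (htc : tailCol Rc ≤ tc) :
    ∑ m ∈ M.erase o, host m - (∑ m ∈ ML, deb m + debTail δ L_D τ)
        - τ * (∑ m ∈ MN, nn m + psiTail δ R_N + 2 * SY * linTail δ L_N)
        - ∑ m ∈ MI, hf m - ∑ m ∈ MI, fc m - (RM + SY * remTail δ L_R τ) - tc
      ≤ certFloorL M MI o pos Y τ Rc := by
  have hL_N : 0 < L_N := lt_of_lt_of_le (by positivity) hLN
  have hL_R : 0 < L_R := lt_of_lt_of_le (by positivity) hLR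
  have hlin := linTail_nonneg hδ hL_N
  have hrem := remTail_nonneg hδ hL_R hτ0 hτR
  have hSY2 : 2 * ∑ x ∈ MI, ‖Y x‖ ≤ 2 * SY := by linarith
  have hD := (debitL_le_near_add_tail (M := M) (pos := pos) o ML hδ hLD hτ0 hτD hsep hML hMLc).trans
    (add_le_add (Finset.sum_le_sum hdeb) le_rfl)
  have hN := (nashL_le_near_add_tails (Y := Y) o nb MN hδ hLN hRN hsep hMI hnb hMN hMNc).trans
    (add_le_add (add_le_add (Finset.sum_le_sum hnn) le_rfl) (mul_le_mul_of_nonneg_right hSY2 hlin))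
  have hHF : ∑ m ∈ MI, ⟪Y m, ∑ m' ∈ M.erase m, ljBondForce (pos m - pos m')⟫ ≤ ∑ m ∈ MI, hf m :=
    Finset.sum_le_sum fun m hm => (hostForceL_le_near_add_tail nbh hδ hsep (hMI hm) (hLh m hm) (hnbh m hm)).trans (hhf m hm)
  have hR := (remL_le_near_add_tail (Y := Y) o nbr hδ hLR hτ0 hτR hsep hMI hnbr).trans
    (add_le_add hRM (mul_le_mul_of_nonneg_right hSY hrem))
  have h := lb_le_certFloorL M MI o pos Y (Rc := Rc) hτ0 (Finset.sum_le_sum hhost) hD hN hHF (Finset.sum_le_sum hfc) hR htc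
  linarith

end Trunc

end Summit.AtomisticToContinuum.Crystallization.Theorems.FrustratedLawDichotomyCellTailsRem
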